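import Summits.RiemannHypothesis.RiemannHypothesis.Theorems.SemilocalNegCertAtoms
import HarnessLib

/-!
# Semi-local thresholds, negative side (IIIa): the CENTRED archimedean majorant on `(0, 4]` and the bulk integral
  over a list of pieces

Cell `rh-explicit` (HOME `run/shared/lean/pub/rh-explicit/`), seat cc-s2-4 gen7 (A4 SEMILOCAL-TABLE, the Lean side).  Honest
framing: theorems about the tree's `weilSemilocalThreshold S`; nothing here bears on RH.  No data is trusted.

Two limits of `WeilNegCertS` (`SemilocalNegCertAtoms.lean`) are removed here:

* WINDOWS `b ≤ 2` (was `b ≤ 1`): the archimedean majorant used `e^{t/2} ≤ E_n(t/2)` on `t ≤ 2`; here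
  `e^{t/2} = (e^{t/4})² ≤ E_n(t/4)²` on `t ≤ 4` (`expUpScaledL`).
* NO SLACK NEAR `t = 2b`, NO SINGLE HEAVY KERNEL FACT: the bound `t/sinh t ≤ 1/(1+u_K(t)) ≤ A_m(u_K(t))` (alternating
  geometric series in `u = u_K(t) ≈ sinh t/t − 1`) converges like `u^{2m+1}`, useless for `u ≳ 0.8` (`t ≳ 2`).  On a PIECE
  `(T₀, T₁]` we CENTRE it: with the rational `u₀ = u_K(T₀) ≤ u_K(t)`,
  `1/(1+u_K(t)) = (1/(1+u₀))·1/(1+x)`, `x = (u_K(t) − u₀)/(1+u₀) ∈ [0, small]`, `1/(1+x) ≤ A_m(x)`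
  (`mul_weilArchDensity_le_centred`, `archMajorCL n m K u₀`).  THEOREM B″ (`setIntegral_weilArchDensity_mul_le_piece`)
  bounds `∫_{(T₀,T₁]} w·D` by the rational `pieceQ`; the bulk `(0, 2b]` is cut at rationals `T₁ < … < T_r = 2b`
  (`pieces_bound`, induction on the cut list).

The certificate consuming these piece bounds is `WeilNegCertP` (`SemilocalNegCertPieces.lean`).  Folklore throughout.
-/

set_option autoImplicit false
set_option linter.dupNamespace false  -- the mandated namespace repeats `RiemannHypothesis`

noncomputable section

open Complex Filter Set MeasureTheory Topology
open scoped Real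

namespace Summit.RiemannHypothesis.RiemannHypothesis.Theorems.SemilocalPolyWitness

open MeasureTheory Set Finset Real
open Literature.NumberTheory.LFunctions
open Summit.RiemannHypothesis.RiemannHypothesis.Theorems.MotivicDoor
open Summit.RiemannHypothesis.RiemannHypothesis.Theorems.MotivicDoor.SemilocalThreshold
open Summit.RiemannHypothesis.RiemannHypothesis.Theorems.MotivicDoor.SemilocalMarkov
open LQ

/-! ## The centred majorant of `t·w(t)` on `(0, 4]` -/

/-- The list of `E_n(c·t) = Σ_{j<n} (ct)^j/j! + (ct)^n (n+1)/(n!·n)`. -/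
def expUpScaledL (n : ℕ) (c : ℚ) : List ℚ :=
  add (expScaledPartL n c) (smul (c ^ n * (n + 1) / (n.factorial * n)) (pow [0, 1] n))
where
  /-- the partial sums `Σ_{j<n} (ct)^j/j!` -/
  expScaledPartL : ℕ → ℚ → List ℚ
  | 0, _ => []
  | j + 1, c => add (expScaledPartL j c) (smul (c ^ j / j.factorial) (pow [0, 1] j))

/-- `ev (expScaledPartL n c) t = Σ_{j<n} (c t)^j/j!`. -/
theorem ev_expScaledPartL (c : ℚ) : ∀ (n : ℕ) (t : ℝ),
    ev (expUpScaledL.expScaledPartL n c) t = ∑ j ∈ range n, ((c : ℝ) * t) ^ j / j.factorial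
  | 0, t => by simp [expUpScaledL.expScaledPartL]
  | j + 1, t => by
      rw [expUpScaledL.expScaledPartL, ev_add, ev_smul, ev_pow, ev_X, ev_expScaledPartL c j t,
        Finset.sum_range_succ]
      push_cast
      ring

/-- `ev (expUpScaledL n c) t = E_n(c·t)`. -/
theorem ev_expUpScaledL (n : ℕ) (c : ℚ) (t : ℝ) : ev (expUpScaledL n c) t = expUp n ((c : ℝ) * t) := by
  rw [expUpScaledL, ev_add, ev_smul, ev_pow, ev_X, ev_expScaledPartL, expUp]
  push_cast
  ring

/-- `u_K` is monotone on `[0, ∞)`. -/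
theorem uSum_mono (K : ℕ) {s t : ℝ} (hs : 0 ≤ s) (hst : s ≤ t) : uSum K s ≤ uSum K t :=
  Finset.sum_le_sum fun k _ ↦ div_le_div_of_nonneg_right (pow_le_pow_left₀ hs hst _) (by positivity)

/-- The centred variable `x = (u_K(t) − u₀)/(1 + u₀)` as a list. -/
def centredL (K : ℕ) (u0 : ℚ) : List ℚ := smul (1 / (1 + u0)) (add (uSumL K) [-u0])

/-- `ev (centredL K u₀) t = (u_K(t) − u₀)/(1+u₀)`. -/
theorem ev_centredL (K : ℕ) (u0 : ℚ) (t : ℝ) :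
    ev (centredL K u0) t = (uSum K t - u0) / (1 + u0) := by
  rw [centredL, ev_smul, ev_add, ev_uSumL]
  simp
  ring

/-- **The centred majorant list** `archMajorCL n m K u₀`: coefficients of
`(1/(2(1+u₀))) · E_n(t/4)² · A_m((u_K(t) − u₀)/(1+u₀))`. -/
def archMajorCL (n m K : ℕ) (u0 : ℚ) : List ℚ :=
  smul (1 / (2 * (1 + u0))) (mul (pow (expUpScaledL n (1 / 4)) 2) (geomL (2 * m + 1) (centredL K u0)))

/-- `ev (archMajorCL n m K u₀) t = (1/(2(1+u₀))) · E_n(t/4)² · A_m((u_K(t) − u₀)/(1+u₀))`. -/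
theorem ev_archMajorCL (n m K : ℕ) (u0 : ℚ) (t : ℝ) :
    ev (archMajorCL n m K u0) t =
      1 / (2 * (1 + u0)) * expUp n (t / 4) ^ 2 * geomAlt m ((uSum K t - u0) / (1 + u0)) := by
  rw [archMajorCL, ev_smul, ev_mul, ev_pow, ev_expUpScaledL, ev_geomL, ev_centredL, geomAlt]
  push_cast
  ring

/-- **LEMMA A′ — centred polynomial majorant of `t·w(t)`**: for `0 < t ≤ 4`, `n ≥ 1` and a rational
`0 ≤ u₀ ≤ u_K(t)`, `t · w(t) ≤ ev (archMajorCL n m K u₀) t`. -/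
theorem mul_weilArchDensity_le_centred (n m K : ℕ) (hn : 0 < n) {u0 : ℚ} (hu0 : 0 ≤ u0) {t : ℝ} (ht : 0 < t)
    (ht4 : t ≤ 4) (hu : (u0 : ℝ) ≤ uSum K t) : t * weilArchDensity t ≤ ev (archMajorCL n m K u0) t := by
  rw [ev_archMajorCL]
  have hsinh : 0 < Real.sinh t := Real.sinh_pos_iff.2 ht
  have hu0' : (0 : ℝ) ≤ u0 := by exact_mod_cast hu0
  set x : ℝ := (uSum K t - u0) / (1 + u0) with hx
  have hx0 : 0 ≤ x := div_nonneg (by linarith) (by linarith)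
  -- t / sinh t ≤ 1/(1+u_K) = (1/(1+u₀)) · 1/(1+x) ≤ (1/(1+u₀)) A_m(x)
  have h1 : t / Real.sinh t ≤ 1 / (1 + uSum K t) := by
    rw [div_le_div_iff₀ hsinh (by linarith [uSum_nonneg K ht.le]), one_mul]
    exact mul_one_add_uSum_le_sinh K ht.le
  have h1' : 1 / (1 + uSum K t) = 1 / (1 + u0) * (1 / (1 + x)) := by
    rw [hx]
    field_simp
    ring
  have h2 : t / Real.sinh t ≤ 1 / (1 + u0) * geomAlt m x := by
    rw [h1'] at h1
    exact h1.trans (mul_le_mul_of_nonneg_left (inv_one_add_le_geomAlt m hx0) (by positivity))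
  -- e^{t/2} ≤ E_n(t/4)²
  have h3 : Real.exp (t / 4) ≤ expUp n (t / 4) := exp_le_expUp hn (by linarith) (by linarith)
  have hE : 0 ≤ expUp n (t / 4) := (Real.exp_pos _).le.trans h3
  have h4 : Real.exp (t / 2) ≤ expUp n (t / 4) ^ 2 := by
    rw [show Real.exp (t / 2) = Real.exp (t / 4) ^ 2 by rw [← Real.exp_nat_mul]; ring_nf]
    exact pow_le_pow_left₀ (Real.exp_pos _).le h3 2
  have e : t * weilArchDensity t = 1 / 2 * Real.exp (t / 2) * (t / Real.sinh t) := by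
    unfold weilArchDensity
    field_simp
  rw [e]
  have hts : 0 ≤ t / Real.sinh t := by positivity
  calc 1 / 2 * Real.exp (t / 2) * (t / Real.sinh t)
      ≤ 1 / 2 * expUp n (t / 4) ^ 2 * (t / Real.sinh t) := by gcongr
    _ ≤ 1 / 2 * expUp n (t / 4) ^ 2 * (1 / (1 + u0) * geomAlt m x) := by gcongr
    _ = 1 / (2 * (1 + ↑u0)) * expUp n (t / 4) ^ 2 * geomAlt m x := by
        field_simp

/-! ## THEOREM B″: the bulk integral on one piece `(T₀, T₁]` -/

/-- The rational piece bound: `[∫ archMajorCL·q]_{T₀}^{T₁}` with the majorant centred at `u₀ = u_K(T₀)`. -/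
def pieceQ (n m K : ℕ) (q : List ℚ) (T0 T1 : ℚ) : ℚ :=
  evQ (integ (mul (archMajorCL n m K (evQ (uSumL K) T0)) q)) T1 -
    evQ (integ (mul (archMajorCL n m K (evQ (uSumL K) T0)) q)) T0

/-- **THEOREM B″.**  Let `0 ≤ T₀ < T₁ ≤ 4` be rationals and let `D` agree on `(T₀, T₁]` with `t · q(t)`, `q ≥ 0` there.
Then `w·D` is integrable on `(T₀, T₁]` and `∫_{(T₀,T₁]} w·D ≤ pieceQ n m K q T₀ T₁`. -/
theorem setIntegral_weilArchDensity_mul_le_piece {q : List ℚ} {D : ℝ → ℝ} {T0 T1 : ℚ} (hT0 : 0 ≤ T0)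
    (hT01 : T0 < T1) (hT4 : (T1 : ℝ) ≤ 4)
    (hD : ∀ t ∈ Ioc (T0 : ℝ) T1, D t = t * ev q t) (hq : ∀ t ∈ Ioc (T0 : ℝ) T1, 0 ≤ ev q t)
    (n m K : ℕ) (hn : 0 < n) :
    IntegrableOn (fun t ↦ weilArchDensity t * D t) (Ioc (T0 : ℝ) T1) ∧
      ∫ t in Ioc (T0 : ℝ) T1, weilArchDensity t * D t ≤ ((pieceQ n m K q T0 T1 : ℚ) : ℝ) := by
  have hT0' : (0 : ℝ) ≤ T0 := by exact_mod_cast hT0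
  have hT01' : (T0 : ℝ) < T1 := by exact_mod_cast hT01
  set u0 : ℚ := evQ (uSumL K) T0 with hu0def
  have hu0R : (u0 : ℝ) = uSum K T0 := by rw [hu0def, ← ev_ratCast, ev_uSumL]
  have hu0 : 0 ≤ u0 := by
    have h := uSum_nonneg K hT0'
    rw [← hu0R] at h
    exact_mod_cast h
  set Mj : ℝ → ℝ := fun t ↦ ev (mul (archMajorCL n m K u0) q) t with hM
  set P : ℝ → ℝ := fun t ↦ weilArchDensity t * (t * ev q t) with hP
  have hMc : Continuous Mj := continuous_ev _
  have hMi : IntegrableOn Mj (Ioc (T0 : ℝ) T1) :=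
    (hMc.integrableOn_Icc (a := (T0 : ℝ)) (b := (T1 : ℝ))).mono_set Ioc_subset_Icc_self
  have hEq : EqOn (fun t ↦ weilArchDensity t * D t) P (Ioc (T0 : ℝ) T1) := fun t ht ↦ by
    simp only [hP, hD t ht]
  have hpt : ∀ t ∈ Ioc (T0 : ℝ) T1, 0 ≤ P t ∧ P t ≤ Mj t := by
    intro t ht
    have ht0 : 0 < t := lt_of_le_of_lt hT0' ht.1
    have hw := weilArchDensity_pos ht0
    have hqt := hq t ht
    refine ⟨mul_nonneg hw.le (mul_nonneg ht0.le hqt), ?_⟩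
    rw [hM, hP]
    simp only
    rw [ev_mul, show weilArchDensity t * (t * ev q t) = (t * weilArchDensity t) * ev q t by ring]
    refine mul_le_mul_of_nonneg_right ?_ hqt
    refine mul_weilArchDensity_le_centred n m K hn hu0 ht0 (ht.2.trans hT4) ?_
    rw [hu0R]
    exact uSum_mono K hT0' ht.1.le
  have hPm : AEStronglyMeasurable P (volume.restrict (Ioc (T0 : ℝ) T1)) := by
    have : Measurable P := by
      rw [hP]
      exact measurable_weilArchDensity.mul (measurable_id.mul (continuous_ev q).measurable)
    exact this.aestronglyMeasurable
  have hPint : IntegrableOn P (Ioc (T0 : ℝ) T1) := by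
    refine Integrable.mono' hMi hPm ?_
    filter_upwards [ae_restrict_mem measurableSet_Ioc] with t ht
    rw [Real.norm_eq_abs, abs_of_nonneg (hpt t ht).1]
    exact (hpt t ht).2
  have hint : IntegrableOn (fun t ↦ weilArchDensity t * D t) (Ioc (T0 : ℝ) T1) :=
    hPint.congr_fun hEq.symm measurableSet_Ioc
  refine ⟨hint, ?_⟩
  calc ∫ t in Ioc (T0 : ℝ) T1, weilArchDensity t * D t
      = ∫ t in Ioc (T0 : ℝ) T1, P t := setIntegral_congr_fun measurableSet_Ioc hEq
    _ ≤ ∫ t in Ioc (T0 : ℝ) T1, Mj t := setIntegral_mono_on hPint hMi measurableSet_Ioc fun t ht ↦ (hpt t ht).2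
    _ = ∫ t in (T0 : ℝ)..T1, Mj t := (intervalIntegral.integral_of_le hT01'.le).symm
    _ = ((pieceQ n m K q T0 T1 : ℚ) : ℝ) := by
        rw [hM, integral_ev, pieceQ, ev_ratCast, ev_ratCast]
        push_cast
        rfl

/-! ## The bulk over a list of cuts -/

/-- The cuts `T₀ < T₁ < … ` are strictly increasing (starting after `T₀`). -/
def cutsOk : ℚ → List ℚ → Bool
  | _, [] => true
  | T0, T1 :: rest => decide (T0 < T1) && cutsOk T1 rest

/-- The last cut (or `T₀` if there is none). -/
def lastCut : ℚ → List ℚ → ℚ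
  | T0, [] => T0
  | _, T1 :: rest => lastCut T1 rest

/-- `Σ` of a rational list. -/
def sumQ : List ℚ → ℚ
  | [] => 0
  | a :: rest => a + sumQ rest

/-- `T₀ ≤ lastCut T₀ cuts` for increasing cuts. -/
theorem le_lastCut : ∀ (T0 : ℚ) (cuts : List ℚ), cutsOk T0 cuts = true → T0 ≤ lastCut T0 cuts
  | T0, [], _ => le_rfl
  | T0, T1 :: rest, h => by
      simp only [cutsOk, Bool.and_eq_true, decide_eq_true_eq] at h
      exact h.1.le.trans (le_lastCut T1 rest h.2)

/-- **The bulk bound over the pieces** (induction on the cut list): if `D = t·q(t)` with `q ≥ 0` on `(T₀, T_r]` and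
every piece integral bound `pieceQ … T_i T_{i+1} ≤ B_i` holds, then `w·D` is integrable on `(T₀, T_r]` and
`∫_{(T₀,T_r]} w·D ≤ Σ B_i`. -/
theorem pieces_bound (n m K : ℕ) (hn : 0 < n) {q : List ℚ} {D : ℝ → ℝ} :
    ∀ (T0 : ℚ) (cuts B : List ℚ), 0 ≤ T0 → cutsOk T0 cuts = true → (lastCut T0 cuts : ℝ) ≤ 4 →
      B.length = cuts.length →
      (∀ t ∈ Ioc (T0 : ℝ) (lastCut T0 cuts), D t = t * ev q t) →
      (∀ t ∈ Ioc (T0 : ℝ) (lastCut T0 cuts), 0 ≤ ev q t) →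
      (∀ i, i < cuts.length → pieceQ n m K q ((T0 :: cuts).getD i 0) (cuts.getD i 0) ≤ B.getD i 0) →
      IntegrableOn (fun t ↦ weilArchDensity t * D t) (Ioc (T0 : ℝ) (lastCut T0 cuts)) ∧
        ∫ t in Ioc (T0 : ℝ) (lastCut T0 cuts), weilArchDensity t * D t ≤ ((sumQ B : ℚ) : ℝ)
  | T0, [], B, _, _, _, hlen, _, _, _ => by
      have hB : B = [] := List.length_eq_zero_iff.1 (by simpa using hlen)
      subst hB
      simp [lastCut, sumQ]
  | T0, T1 :: rest, B, hT0, hcuts, h4, hlen, hD, hq, hB => by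
      obtain ⟨B0, Brest, rfl⟩ : ∃ B0 Brest, B = B0 :: Brest := by
        cases B with
        | nil => simp at hlen
        | cons a l => exact ⟨a, l, rfl⟩
      simp only [cutsOk, Bool.and_eq_true, decide_eq_true_eq] at hcuts
      obtain ⟨h01, hrest⟩ := hcuts
      simp only [lastCut] at h4 hD hq ⊢
      have hlen' : Brest.length = rest.length := by simpa using hlen
      have hT1last : (T1 : ℝ) ≤ lastCut T1 rest := by exact_mod_cast le_lastCut T1 rest hrest
      have hT01' : (T0 : ℝ) ≤ T1 := by exact_mod_cast h01.le
      -- the first piece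
      have hpiece := setIntegral_weilArchDensity_mul_le_piece (q := q) (D := D) hT0 h01 (hT1last.trans h4)
        (fun t ht ↦ hD t ⟨ht.1, ht.2.trans hT1last⟩) (fun t ht ↦ hq t ⟨ht.1, ht.2.trans hT1last⟩) n m K hn
      have hB0 : pieceQ n m K q T0 T1 ≤ B0 := by simpa using hB 0 (by simp)
      -- the rest
      have hrec := pieces_bound n m K hn T1 rest Brest (hT0.trans h01.le) hrest h4 hlen'
        (fun t ht ↦ hD t ⟨lt_of_le_of_lt hT01' ht.1, ht.2⟩) (fun t ht ↦ hq t ⟨lt_of_le_of_lt hT01' ht.1, ht.2⟩)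
        (fun i hi ↦ by simpa using hB (i + 1) (by simpa using hi))
      have hunion : Ioc (T0 : ℝ) T1 ∪ Ioc (T1 : ℝ) (lastCut T1 rest) = Ioc (T0 : ℝ) (lastCut T1 rest) :=
        Ioc_union_Ioc_eq_Ioc hT01' hT1last
      rw [← hunion]
      refine ⟨hpiece.1.union hrec.1, ?_⟩
      rw [setIntegral_union (Ioc_disjoint_Ioc_of_le le_rfl) measurableSet_Ioc hpiece.1 hrec.1, sumQ]
      push_cast
      have h1 : ((pieceQ n m K q T0 T1 : ℚ) : ℝ) ≤ B0 := by exact_mod_cast hB0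
      linarith [hpiece.2, hrec.2]

end Summit.RiemannHypothesis.RiemannHypothesis.Theorems.SemilocalPolyWitness

end
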